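import Mathlib
import Summits.HodgeConjecture.FermatCycles.HodgeFermatLemmaNB
import Summits.HodgeConjecture.FermatCycles.HodgeFermatLemmaO

/-!
# THEOREM L of `tables/DPRIME-THEOREM.md` §3 — the generic rows, part 1: (Z3, U) and (Z3, Z1) (`HodgeFermat/TheoremLRows.lean`; HF-G21d)

Tree copy (part 1 of 2) of the module `HodgeFermat/TheoremLRows.lean` of the sibling cell's standalone package
`run/shared/lean/pub/pub-hodgefermat/lean/HodgeFermat/` (513 lines, sha256 `1379ebcc671acce7…`), source lines 41–286 (§§1–4: unit lifts, residues, the Z3 fibre count, the rows (Z3, U) `row_Z3U` and (Z3, Z1) `row_Z3Z1` with their variants at 7 and 5).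
Filed by cell `pub-hfermat`, seat prover-1 gen-3, on the COORDINATOR KEEPER RULING of 2026-08-25 (gem sweep H1: take the
off-gate kernel theorem `thmFstar` through the gate) — here THEOREM F* of `tables/DPRIME-THEOREM.md` §9 IN FULL, i.e.
PROPOSITION D′(3N) and the descent (`HodgeFermat/PropDPrimeNFinal.lean`, GATE HF-G34), the last off-gate form of THEOREM F*
(its first two forms, `DecodingFinal.thmFstar` = F* at the prime levels and `ThmFstarNFinal.thmFstar` = F*(3N), landed on
2026-08-25 as `HodgeFermatThmFstar.lean` / `HodgeFermatThmFstarN.lean`, seats prover-1 gen-0 / gen-2); this file is one link of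
the import closure of `PropDPrimeNFinal.propDprime` (the sibling's KR-free chain: THEOREM L, COROLLARY M, THEOREM D6,
THEOREM U⁺, THEOREM KR6, THEOREM Z3U) on top of those landed chains.  The source module is the sibling's hub-checked module of
record (pub-hodgefermat `CERT.md` l.873, GATE HF-G21d; cell record `check/TheoremLRows_standalone.lean` sha256 `afc78fc89e44f5b5…`); its declarations are copied VERBATIM.
Deviations from the source module, exhaustively: the `import` lines (tree modules `Summits.HodgeConjecture.FermatCycles.
HodgeFermat*` instead of `HodgeFermat.*`); this module docstring; one-line docstrings added (gate lint) to `coprime_t₁`, `rsum_tri`; the file ends at source l.286 with an `end` line (part 2 = `HodgeFermatTheoremLRowsB.lean`).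
Every other line — in particular every declaration's statement and proof — is byte-identical to the source.
HONEST FRAMING: explicit algebraic cycles for specific Hodge classes on Fermat/Delsarte varieties; residual open instances
listed; no claim on general Hodge.  (This file is arithmetic of CM types / finite combinatorics / analytic number theory
of the sibling's KR-free programme; it claims nothing about cycles.)

The source module's docstring (TheoremLRows.lean l.4–39), verbatim:

## THEOREM L of `tables/DPRIME-THEOREM.md` §3 — the four GENERIC ROWS, kernel-checked for every prime and level
## (build hodge-fermat, generation 21, second addendum)

THEOREM L (the local sieve) compares, for a coincidence `(T, T′)` of level `m = pn` (same CM type, `p ∤ n`), the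
fibre counts `N_T ≡ N_{T′}` of LEMMA N on the units of `ℤ/n`, pattern by pattern at `p`
(U = all entries prime to `p`, Z1 = exactly one entry divisible by `p`, Z3 = all three divisible by `p`).
This file proves the four rows whose proofs in DPRIME §3 are pure window arguments on LEMMA N + LEMMA O
(no F-facts, no DESCENT), each in the QUANTITATIVE form the hand proof actually establishes, followed by the
prime ranges in which it is an outright contradiction:

* `row_Z3U`   : (Z3, U) is impossible for every prime `p ≥ 5` (any `n ≥ 1`).
* `row_Z3Z1`  : (Z3, Z1) with `T′ = (py, x₂, x₃)`, `y ≢ 0 (mod n)`, `n` odd, `p ≥ 5`:  `p·(n − g) < 4n`, `g = gcd(y, n)`;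
  hence impossible for `p ≥ 7` (`row_Z3Z1_seven`), and for `p = 5` it forces `n/g = 3`, i.e. `3g = n` and
  `y mod n ∈ {n/3, 2n/3}` (`row_Z3Z1_five`: "the 5-divisible entry of the Z1-triple is ±m/3").
* `row_Z1Z1`  : (Z1, Z1) with `T = (py, …)`, `T′ = (py′, …)`, `y ≢ y′ (mod n)` (disjointness), `n` odd, `p ≥ 7`:
  `p·(n − g) < 6n`, `g = gcd(y − y′, n)`; hence impossible for `p ≥ 11` (`row_Z1Z1_eleven`), and for `p = 7` it forces
  `n/g < 7` (`row_Z1Z1_seven`: `n/g ∈ {3, 5}`).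
* `row_UZ1`   : (U, Z1) with `T = (py, x₂, x₃)`, `y ≢ 0 (mod n)`: `(p − 5)·n ≤ 2p·g`, `g = gcd(y, n)` (i.e. `n/g ≤ 2p/(p−5)`);
  hence impossible for `p ≥ 17` and `n` odd (`row_UZ1_seventeen`).

Setting (the ℕ-model of `PropL5.lean` / `LemmaN.lean`): level `N = p*n`, `p` prime, `p ∤ n`, `n ≥ 1`; a triple is
`(x₁, x₂, x₃) : ℕ³` with `p*n ∣ x₁ + x₂ + x₃`; "unit at p" = `¬ p ∣ xᵢ`; the Z1-triple is written `(p*y, x₂, x₃)`, the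
Z3-triple `(p*a, p*b, p*c)` (no further hypothesis on it is needed); `SameType (p*n) T T′` = equal CM types on the units.
No non-degeneracy of `T mod n` is assumed: the bound `|c_T(t̄) − c_T(t̄′)| ≤ 1` for units `t̄, t̄′` (`delta_le`) is proved
for all triples, by the zero pattern of the residues.

Inputs: `lemmaN_U`, `lemmaN_Z1`, `fibre_identity_Z1Z1`, `fibre_identity_Z1U`, `fibreCount_congr`, `first_mod`,
`nonunit_exists/unique`, `lift_coprime`, `rsum_dvd` (from `LemmaN.lean`) and `lemmaO_g`, `lemmaO_half_sub`, `lemmaO_mem`,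
`decompose`, `two_le_quot`, `quot_odd` (from `LemmaO.lean`).  New here: `fibreCount_Z3` (`N_T ∈ {0, p−1}` for a Z3-triple),
`delta_le`, and the rows.

Inside the package: `lake build HodgeFermat.TheoremLRows`.  For the hub `lean check` use the self-contained concatenation
`check/TheoremLRows_standalone.lean` (`code/gen21/mkstandalone.py`).  `set_option autoImplicit false`; no `sorry`, no
`native_decide`; axioms of every theorem = [propext, Classical.choice, Quot.sound].
-/

set_option autoImplicit false

namespace HodgeFermat.KRFree.TheoremL

open Finset HodgeFermat.KRFree.LemmaN HodgeFermat.KRFree.LemmaO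

/-! ## Units of `ℤ/n` -/

/-- `p̄⁻¹ū` has a representative: `p t₁ ≡ u (mod n)` -/
lemma exists_t₁ (p n u : ℕ) (hp : p.Prime) (hpn : ¬ p ∣ n) (hn : 0 < n) : ∃ t₁, p * t₁ ≡ u [MOD n] := by
  have hco : Nat.Coprime p n := (Nat.Prime.coprime_iff_not_dvd hp).mpr hpn
  obtain ⟨m, _, hm⟩ := Nat.exists_mul_mod_eq_of_coprime u hco hn.ne'
  exact ⟨m, hm⟩

/-- a solution `t₁` of `p·t₁ ≡ u (mod n)` with `u` a unit is itself a unit mod `n` -/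
lemma coprime_t₁ {p n u t₁ : ℕ} (h : p * t₁ ≡ u [MOD n]) (hu : Nat.Coprime u n) : Nat.Coprime t₁ n := by
  have h1 : Nat.Coprime (p * t₁) n := by
    unfold Nat.Coprime at hu ⊢
    rw [Nat.ModEq.gcd_eq h]
    exact hu
  exact Nat.Coprime.coprime_mul_left h1

/-- two units of `ℤ/n` kill the same entries -/
lemma res_cases (n e t t' : ℕ) (ht : Nat.Coprime t n) (ht' : Nat.Coprime t' n) :
    (t * e % n = 0 ∧ t' * e % n = 0) ∨ (0 < t * e % n ∧ 0 < t' * e % n) := by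
  by_cases he : n ∣ e
  · left
    obtain ⟨c, rfl⟩ := he
    constructor
    · rw [mul_left_comm, Nat.mul_mod_right]
    · rw [mul_left_comm, Nat.mul_mod_right]
  · right
    constructor
    · exact Nat.pos_of_ne_zero
        (fun h => he (Nat.Coprime.dvd_of_dvd_mul_left ht.symm (Nat.dvd_of_mod_eq_zero h)))
    · exact Nat.pos_of_ne_zero
        (fun h => he (Nat.Coprime.dvd_of_dvd_mul_left ht'.symm (Nat.dvd_of_mod_eq_zero h)))

/-! ## Carries: `c ∈ {0, 1, 2}` and `|c(t̄) − c(t̄′)| ≤ 1` for units -/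

/-- the residue sum of a zero-sum triple is `0`, `n` or `2n` -/
lemma rsum_tri (n x y z t : ℕ) (hn : 0 < n) (hs : n ∣ x + y + z) :
    rsum n (x, y, z) t = 0 ∨ rsum n (x, y, z) t = n ∨ rsum n (x, y, z) t = 2 * n := by
  obtain ⟨c, hc⟩ := rsum_dvd t hs
  have hb : rsum n (x, y, z) t < 3 * n := by
    unfold rsum
    have h1 : t * x % n < n := Nat.mod_lt _ hn
    have h2 : t * y % n < n := Nat.mod_lt _ hn
    have h3 : t * z % n < n := Nat.mod_lt _ hn
    simp only
    omega
  rw [hc] at hb ⊢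
  have hc3 : c < 3 := Nat.lt_of_mul_lt_mul_left (by rw [mul_comm 3 n] at hb; exact hb)
  interval_cases c <;> simp [mul_comm]

/-- the carries of a triple at two units of `ℤ/n` differ by at most one -/
lemma delta_le (n x y z t t' : ℕ) (hn : 0 < n) (hs : n ∣ x + y + z) (ht : Nat.Coprime t n)
    (ht' : Nat.Coprime t' n) :
    rsum n (x, y, z) t ≤ rsum n (x, y, z) t' + n ∧ rsum n (x, y, z) t' ≤ rsum n (x, y, z) t + n := by
  have h1 := rsum_tri n x y z t hn hs
  have h2 := rsum_tri n x y z t' hn hs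
  have bx : t * x % n < n := Nat.mod_lt _ hn
  have bz : t * z % n < n := Nat.mod_lt _ hn
  have bx' : t' * x % n < n := Nat.mod_lt _ hn
  have bz' : t' * z % n < n := Nat.mod_lt _ hn
  have by_ : t * y % n < n := Nat.mod_lt _ hn
  have by' : t' * y % n < n := Nat.mod_lt _ hn
  have cx := res_cases n x t t' ht ht'
  have cy := res_cases n y t t' ht ht'
  have cz := res_cases n z t t' ht ht'
  unfold rsum at h1 h2 ⊢
  simp only at h1 h2 ⊢
  rcases cx with ⟨a1, a2⟩ | ⟨a1, a2⟩ <;> rcases cy with ⟨b1, b2⟩ | ⟨b1, b2⟩ <;>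
    rcases cz with ⟨c1, c2⟩ | ⟨c1, c2⟩ <;> omega

/-- `n ∣ x₁ + x₂ + x₃` from the level condition at `pn` -/
lemma dvd_of_level {p n s : ℕ} (hs : p * n ∣ s) : n ∣ s := Nat.dvd_trans ⟨p, by ring⟩ hs

/-! ## The Z3 pattern: `N_T(t̄₀) ∈ {0, p − 1}` -/

/-- for `T = (pa, pb, pc)` the residues of the lifts of `t̄₀` do not depend on the lift, so either all `p − 1`
unit lifts lie in `H_T` or none does -/
lemma fibreCount_Z3 (p n a b c t₀ : ℕ) (hp : p.Prime) (hpn : ¬ p ∣ n) (ht₀ : Nat.Coprime t₀ n) :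
    fibreCount p n (p * a, p * b, p * c) t₀ = 0 ∨ fibreCount p n (p * a, p * b, p * c) t₀ = p - 1 := by
  obtain ⟨j₀, hj₀, hdiv⟩ := nonunit_exists p n t₀ hp hpn
  have hconst : ∀ j, InH (p * n) (p * a, p * b, p * c) (t₀ + j * n)
      ↔ p * (t₀ * a % n) + p * (t₀ * b % n) < p * n := by
    intro j
    show (t₀ + j * n) * (p * a) % (p * n) + (t₀ + j * n) * (p * b) % (p * n) < p * n ↔ _
    rw [first_mod, first_mod]
  have hunit : ∀ j, j < p → (Nat.Coprime (t₀ + j * n) (p * n) ↔ j ≠ j₀) := by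
    intro j hj
    constructor
    · intro hco hjj
      subst hjj
      have h1 : Nat.Coprime p (p * n) := Nat.Coprime.coprime_dvd_left hdiv hco
      unfold Nat.Coprime at h1
      rw [Nat.gcd_mul_right_right] at h1
      exact hp.one_lt.ne' h1
    · intro hne
      apply lift_coprime hp ht₀
      intro hd
      exact hne (nonunit_unique hp hpn hj hj₀ hd hdiv)
  by_cases hI : p * (t₀ * a % n) + p * (t₀ * b % n) < p * n
  · right
    unfold fibreCount
    have he : (range p).filter (fun j => Nat.Coprime (t₀ + j * n) (p * n)
        ∧ InH (p * n) (p * a, p * b, p * c) (t₀ + j * n)) = (range p).erase j₀ := by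
      ext j
      simp only [Finset.mem_filter, Finset.mem_range, Finset.mem_erase]
      constructor
      · rintro ⟨hj, hco, _⟩
        exact ⟨(hunit j hj).mp hco, hj⟩
      · rintro ⟨hne, hj⟩
        exact ⟨hj, (hunit j hj).mpr hne, (hconst j).mpr hI⟩
    rw [he, Finset.card_erase_of_mem (Finset.mem_range.mpr hj₀), Finset.card_range]
  · left
    unfold fibreCount
    apply Finset.card_eq_zero.mpr
    apply Finset.filter_eq_empty_iff.mpr
    intro j _ h
    exact hI ((hconst j).mp h.2)

/-- `n/g ≥ 3` for `z ≢ 0` and odd `n`: `3·gcd(z, n) ≤ n` -/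
lemma three_gcd_le (n z : ℕ) (hn : 0 < n) (hodd : Odd n) (hz : ¬ n ∣ z) : 3 * Nat.gcd z n ≤ n := by
  obtain ⟨n', z', _, hn', _, _, hdn⟩ := decompose n z hn
  have h2 := two_le_quot n z hn hz
  have ho := quot_odd n z hn hodd
  rw [hdn] at h2 ho
  have h3 : 3 ≤ n' := by
    rcases ho with ⟨k, hk⟩
    omega
  calc 3 * Nat.gcd z n ≤ n' * Nat.gcd z n := Nat.mul_le_mul_right _ h3
    _ = n := by rw [mul_comm, ← hn']

/-! ## Row (Z3, U) -/

/-- **THEOREM L, row (Z3, U):** for `p ≥ 5` a Z3-triple and a U-triple of level `pn` never have the same CM type. -/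
theorem row_Z3U (p n a b c x y z : ℕ) (hp : p.Prime) (h5 : 5 ≤ p) (hpn : ¬ p ∣ n) (hn : 0 < n)
    (hs : p * n ∣ x + y + z) (hx : ¬ p ∣ x) (hy : ¬ p ∣ y) (hz : ¬ p ∣ z)
    (hH : SameType (p * n) (p * a, p * b, p * c) (x, y, z)) : False := by
  obtain ⟨t₁, ht₁⟩ := exists_t₁ p n 1 hp hpn hn
  have h1u : Nat.Coprime 1 n := Nat.coprime_one_left n
  have ht₁u := coprime_t₁ ht₁ h1u
  have hF := fibreCount_Z3 p n a b c 1 hp hpn h1u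
  rw [fibreCount_congr hH] at hF
  have hN := lemmaN_U p n x y z 1 t₁ hp hpn hn hs hx hy hz h1u ht₁
  have hd := delta_le n x y z 1 t₁ hn (dvd_of_level hs) h1u ht₁u
  have h5n : 5 * n ≤ p * n := Nat.mul_le_mul_right n h5
  obtain ⟨F, hFd⟩ : ∃ F, fibreCount p n (x, y, z) 1 = F := ⟨_, rfl⟩
  obtain ⟨R₀, hR₀⟩ : ∃ R, rsum n (x, y, z) 1 = R := ⟨_, rfl⟩
  obtain ⟨R₁, hR₁⟩ : ∃ R, rsum n (x, y, z) t₁ = R := ⟨_, rfl⟩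
  rw [hFd] at hF hN
  rw [hR₀, hR₁] at hN hd
  rcases hF with h0 | h0
  · subst h0
    omega
  · have e : 2 * n * F + 2 * n = 2 * (p * n) := by rw [h0]; zify [hp.one_le]; ring
    omega

/-! ## Row (Z3, Z1) -/

/-- **THEOREM L, row (Z3, Z1), quantitative form:** `p(n − g) < 4n` with `g = gcd(y, n)`. -/
theorem row_Z3Z1 (p n a b c y x₂ x₃ : ℕ) (hp : p.Prime) (h5 : 5 ≤ p) (hpn : ¬ p ∣ n) (hn : 0 < n)
    (hodd : Odd n) (hs : p * n ∣ p * y + x₂ + x₃) (hx₂ : ¬ p ∣ x₂) (hx₃ : ¬ p ∣ x₃) (hy : ¬ n ∣ y)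
    (hH : SameType (p * n) (p * a, p * b, p * c) (p * y, x₂, x₃)) :
    p * (n - Nat.gcd y n) < 4 * n := by
  obtain ⟨u, hu, h2v⟩ := lemmaO_half_sub n y hn hodd hy
  obtain ⟨t₁, ht₁⟩ := exists_t₁ p n u hp hpn hn
  have ht₁u := coprime_t₁ ht₁ hu
  have hF := fibreCount_Z3 p n a b c u hp hpn hu
  rw [fibreCount_congr hH] at hF
  have hN := lemmaN_Z1 p n y x₂ x₃ u t₁ hp hpn hn hs hx₂ hx₃ hu ht₁
  have hd := delta_le n (p * y) x₂ x₃ u t₁ hn (dvd_of_level hs) hu ht₁u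
  have h3g := three_gcd_le n y hn hodd hy
  have hgn : Nat.gcd y n ≤ n := Nat.le_of_dvd hn (Nat.gcd_dvd_right _ _)
  have h5n : 5 * n ≤ p * n := Nat.mul_le_mul_right n h5
  -- opaque names for the atoms of the linear arithmetic
  obtain ⟨g, hg⟩ : ∃ g, Nat.gcd y n = g := ⟨_, rfl⟩
  obtain ⟨v, hv⟩ : ∃ v, u * y % n = v := ⟨_, rfl⟩
  obtain ⟨F, hFd⟩ : ∃ F, fibreCount p n (p * y, x₂, x₃) u = F := ⟨_, rfl⟩
  obtain ⟨R₀, hR₀⟩ : ∃ R, rsum n (p * y, x₂, x₃) u = R := ⟨_, rfl⟩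
  obtain ⟨R₁, hR₁⟩ : ∃ R, rsum n (p * y, x₂, x₃) t₁ = R := ⟨_, rfl⟩
  rw [hg] at h2v h3g hgn ⊢
  rw [hv] at h2v hN
  rw [hFd] at hF hN
  rw [hR₀, hR₁] at hN hd
  obtain ⟨k, hk⟩ : ∃ k, p * v / n = k := ⟨_, rfl⟩
  rw [hk] at hN
  have hk1 : n * k ≤ p * v := by rw [← hk]; exact Nat.mul_div_le (p * v) n
  have hk2 : p * v < n * k + n := by
    have h1 := Nat.div_add_mod (p * v) n
    have h2 := Nat.mod_lt (p * v) hn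
    rw [hk] at h1
    omega
  have hng : n = 2 * v + g := by omega
  have e1 : p * n = 2 * (p * v) + p * g := by rw [hng]; ring
  have e3 : 3 * (p * g) ≤ p * n := by
    calc 3 * (p * g) = p * (3 * g) := by ring
      _ ≤ p * n := Nat.mul_le_mul_left p h3g
  have e4 : p * (n - g) + p * g = p * n := by rw [← Nat.mul_add, Nat.sub_add_cancel hgn]
  rcases hF with h0 | h0
  · subst h0
    omega
  · have e : n * F + n = p * n := by rw [h0]; zify [hp.one_le]; ring
    omega

/-- row (Z3, Z1) is impossible for `p ≥ 7` -/
theorem row_Z3Z1_seven (p n a b c y x₂ x₃ : ℕ) (hp : p.Prime) (h7 : 7 ≤ p) (hpn : ¬ p ∣ n) (hn : 0 < n)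
    (hodd : Odd n) (hs : p * n ∣ p * y + x₂ + x₃) (hx₂ : ¬ p ∣ x₂) (hx₃ : ¬ p ∣ x₃) (hy : ¬ n ∣ y)
    (hH : SameType (p * n) (p * a, p * b, p * c) (p * y, x₂, x₃)) : False := by
  have h := row_Z3Z1 p n a b c y x₂ x₃ hp (by omega) hpn hn hodd hs hx₂ hx₃ hy hH
  have h3g := three_gcd_le n y hn hodd hy
  have hgn : Nat.gcd y n ≤ n := Nat.le_of_dvd hn (Nat.gcd_dvd_right _ _)
  have h7' : 7 * (n - Nat.gcd y n) ≤ p * (n - Nat.gcd y n) := Nat.mul_le_mul_right _ h7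
  omega

/-- row (Z3, Z1) at `p = 5`: `n/g = 3`, i.e. `3g = n` and the 5-divisible entry `5y` of the Z1-triple is `±m/3`
(`y ≡ n/3` or `2n/3 (mod n)`) -/
theorem row_Z3Z1_five (n a b c y x₂ x₃ : ℕ) (h5n : ¬ 5 ∣ n) (hn : 0 < n) (hodd : Odd n)
    (hs : 5 * n ∣ 5 * y + x₂ + x₃) (hx₂ : ¬ 5 ∣ x₂) (hx₃ : ¬ 5 ∣ x₃) (hy : ¬ n ∣ y)
    (hH : SameType (5 * n) (5 * a, 5 * b, 5 * c) (5 * y, x₂, x₃)) :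
    3 * Nat.gcd y n = n ∧ (y % n = n / 3 ∨ y % n = 2 * (n / 3)) := by
  have h := row_Z3Z1 5 n a b c y x₂ x₃ (by norm_num) le_rfl h5n hn hodd hs hx₂ hx₃ hy hH
  obtain ⟨n', z', hn'0, hn', _, _, hdn⟩ := decompose n y hn
  have h2 := two_le_quot n y hn hy
  have ho := quot_odd n y hn hodd
  rw [hdn] at h2 ho
  have hgn : Nat.gcd y n ≤ n := Nat.le_of_dvd hn (Nat.gcd_dvd_right _ _)
  -- n < 5g, so n′ < 5, and n′ odd ≥ 2 gives n′ = 3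
  have hlt : Nat.gcd y n * n' < Nat.gcd y n * 5 := by rw [← hn']; omega
  have hn'5 : n' < 5 := Nat.lt_of_mul_lt_mul_left hlt
  have hn'3 : n' = 3 := by
    rcases ho with ⟨k, hk⟩
    omega
  rw [hn'3] at hn' hdn
  refine ⟨by omega, ?_⟩
  -- y mod n = g·s with s < 3, gcd(s, 3) = 1 (LEMMA O at u = 1)
  obtain ⟨s, hs3, hsc, he⟩ := lemmaO_mem n y 1 hn (Nat.coprime_one_left n)
  rw [hdn] at hs3 hsc
  rw [Nat.one_mul] at he
  have hdiv3 : n / 3 = Nat.gcd y n := Nat.div_eq_of_eq_mul_right (by norm_num) (by omega)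
  rw [hdiv3, he]
  interval_cases s
  · exact absurd hsc (by decide)
  · left; rw [Nat.mul_one]
  · right; omega


end HodgeFermat.KRFree.TheoremL
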